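import Mathlib
import Literature.AlgebraicGeometry.Resolution.CobordantGame
import Literature.AlgebraicGeometry.Resolution.CobordantChartCoefficients
import Literature.AlgebraicGeometry.Resolution.FormalCoordinateChange
import Summits.ResolutionOfSingularities.ResolutionOfSingularities.Theorems.WeightedInvariantGlobalizeLocalDropCanonize
import Summits.ResolutionOfSingularities.ResolutionOfSingularities.Theorems.WeightedInvariantLocalWeightedDropUnaryConeForm

/-!
# `WeightedInvariant.LocalWeightedDrop`, line `hasse-ridge-face-selection`: CORE W″ at `d = 2` reduces to winning the
# normal forms `U y² + a₁ y + a₀`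

Crux item stmt-ResolutionOfSingularities-8899 `LocalWeightedDrop` (route `ResolutionOfSingularities/WeightedInvariant`),
serving the door `WeightedConstruction` stmt-ResolutionOfSingularities-0571.  [OURS · L1 W4.3, chain w43, stub worker 3: helper
N2 of CRUX-PLAN w43 §3C for the piece S2 `stub_charTwoDoublePointSurfaceWon` of skeleton v19.  Not a statement of any manuscript.]

BOOKKEEPING ONLY.  The registered piece S2 (`p = 2`, surface germs of order `2` with square tangent quadric, over `k = k̄`) follows
from the statement «every normal form `U · y² + a₁(x') · y + a₀(x')` with `U(0) = 1`, `ord a₁ ≥ 2`, `ord a₀ ≥ 3` is won, given the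
singular germs in `≤ 2` variables» (`charTwoDoublePointSurfaceWon_of_normalForms`): straighten by `UnaryConeForm.normalForm_of_sq`
and transport the winning region along the linear change (`won_subst_iff`).  The converse bookkeeping
(`normalForm_isSingular`, `normalForm_order`, `normalForm_sq`: a normal form IS a singular order-`2` germ with square tangent quadric
`y²`) is recorded too, so that the two statements are literally equivalent given the lower-dimensional germs
(`charTwoDoublePointSurfaceWon_iff_normalForms`).  The mathematics of S2 is thereby isolated in the normal-form statement
(CRUX-PLAN §3C: D1/N3/N4).
-/

set_option linter.dupNamespace false -- mandated namespace of this single-conjunct summit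

namespace Summit.ResolutionOfSingularities.ResolutionOfSingularities.Theorems

open Literature.AlgebraicGeometry.Resolution

namespace CharTwoDoublePoint

open MvPowerSeries Literature.AlgebraicGeometry.Resolution.CobordantGame

variable {k : Type} [Field k]

/-- The linear part of the linear substitution `x ↦ M x` is `M` (in the `FormalCoordChange.linMat` spelling). -/
theorem linMat_linSubst {N : ℕ} (M : Matrix (Fin N) (Fin N) k) :
    FormalCoordChange.linMat (FormalCoordChange.linSubst M) = M :=
  ConeDichotomy.linMat_linSubst M

/-! ### The normal forms are singular order-`2` germs with tangent quadric `y²` -/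

variable {m : ℕ}

/-- COEFFICIENTS OF A NORMAL FORM at `x'^β y^n`: `U`-part for `n ≥ 2`, `a₀`-part for `n = 0`, `a₁`-part for `n = 1`. -/
theorem coeff_normalForm (U : MvPowerSeries (Fin (m + 1)) k) (a₀ a₁ : MvPowerSeries (Fin m) k) (β : Fin m →₀ ℕ) (n : ℕ) :
    coeff (Finsupp.embDomain (Fin.succAboveEmb (Fin.last m)) β + Finsupp.single (Fin.last m) n)
        (U * X (Fin.last m) ^ 2 +
          (rename (Fin.succAboveEmb (Fin.last m)) a₀ + rename (Fin.succAboveEmb (Fin.last m)) a₁ * X (Fin.last m))) =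
      (if 2 ≤ n then
          coeff (Finsupp.embDomain (Fin.succAboveEmb (Fin.last m)) β + Finsupp.single (Fin.last m) (n - 2)) U
        else 0) +
        ((if n = 0 then coeff β a₀ else 0) + (if n = 1 then coeff β a₁ else 0)) := by
  rw [map_add, map_add, TschirnhausForm.coeff_emb_add_single_mul_X_pow, TschirnhausForm.coeff_emb_add_single_rename,
    ← pow_one (X (Fin.last m)), TschirnhausForm.coeff_emb_add_single_mul_X_pow]
  congr 2
  by_cases h1 : 1 ≤ n
  · rw [if_pos h1, TschirnhausForm.coeff_emb_add_single_rename]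
    by_cases h2 : n = 1
    · rw [if_pos (by omega), if_pos h2]
    · rw [if_neg (by omega), if_neg h2]
  · rw [if_neg h1, if_neg (by omega)]

/-- A normal form with `ord a₀ ≥ 3`, `ord a₁ ≥ 2` has no monomial of degree `< 2`, and in degree `2` only `U(0) · y²`. -/
theorem coeff_normalForm_of_degree_le (U : MvPowerSeries (Fin (m + 1)) k) (a₀ a₁ : MvPowerSeries (Fin m) k)
    (ha₀ : (2 : ℕ∞) < a₀.order) (ha₁ : (1 : ℕ∞) < a₁.order) (E : Fin (m + 1) →₀ ℕ) (hE : E.degree ≤ 2) :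
    coeff E (U * X (Fin.last m) ^ 2 +
        (rename (Fin.succAboveEmb (Fin.last m)) a₀ + rename (Fin.succAboveEmb (Fin.last m)) a₁ * X (Fin.last m))) =
      if E = Finsupp.single (Fin.last m) 2 then constantCoeff U else 0 := by
  classical
  obtain ⟨β, hEeq⟩ := TschirnhausForm.exists_eq_emb_add_single E
  set n := E (Fin.last m) with hn
  have hdeg : E.degree = β.degree + n := by rw [hEeq, TschirnhausForm.degree_emb_add_single]
  rw [hEeq, coeff_normalForm]
  have h0 : (if n = 0 then coeff β a₀ else 0) = 0 := by
    split_ifs with h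
    · apply coeff_of_lt_order
      refine lt_of_le_of_lt ?_ ha₀
      exact_mod_cast (by omega : β.degree ≤ 2)
    · rfl
  have h1 : (if n = 1 then coeff β a₁ else 0) = 0 := by
    split_ifs with h
    · apply coeff_of_lt_order
      refine lt_of_le_of_lt ?_ ha₁
      exact_mod_cast (by omega : β.degree ≤ 1)
    · rfl
  rw [h0, h1, add_zero, add_zero]
  by_cases h2 : 2 ≤ n
  · have hn2 : n = 2 := by omega
    have hβ : β = 0 := by
      have : β.degree = 0 := by omega
      exact (Finsupp.degree_eq_zero_iff β).mp this
    rw [if_pos h2, hn2, hβ, Nat.sub_self, Finsupp.single_zero, add_zero, Finsupp.embDomain_zero,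
      coeff_zero_eq_constantCoeff_apply, zero_add, if_pos rfl]
  · rw [if_neg h2, if_neg]
    intro h
    have h' := DFunLike.congr_fun h (Fin.last m)
    rw [TschirnhausForm.emb_add_single_last, Finsupp.single_eq_same] at h'
    omega

/-- A normal form has order `≥ 2`. -/
theorem two_le_order_normalForm (U : MvPowerSeries (Fin (m + 1)) k) (a₀ a₁ : MvPowerSeries (Fin m) k)
    (ha₀ : (2 : ℕ∞) < a₀.order) (ha₁ : (1 : ℕ∞) < a₁.order) :
    (2 : ℕ∞) ≤ (U * X (Fin.last m) ^ 2 +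
        (rename (Fin.succAboveEmb (Fin.last m)) a₀ + rename (Fin.succAboveEmb (Fin.last m)) a₁ * X (Fin.last m))).order := by
  refine nat_le_order fun E hE => ?_
  rw [coeff_normalForm_of_degree_le U a₀ a₁ ha₀ ha₁ E (by exact_mod_cast hE.le), if_neg]
  rintro rfl
  rw [Finsupp.degree_single] at hE
  exact absurd hE (by norm_num)

/-- A normal form with `U(0) ≠ 0` has order exactly `2`. -/
theorem order_normalForm {U : MvPowerSeries (Fin (m + 1)) k} (hU : constantCoeff U ≠ 0) (a₀ a₁ : MvPowerSeries (Fin m) k)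
    (ha₀ : (2 : ℕ∞) < a₀.order) (ha₁ : (1 : ℕ∞) < a₁.order) :
    (U * X (Fin.last m) ^ 2 +
        (rename (Fin.succAboveEmb (Fin.last m)) a₀ + rename (Fin.succAboveEmb (Fin.last m)) a₁ * X (Fin.last m))).order = 2 := by
  refine le_antisymm ?_ (two_le_order_normalForm U a₀ a₁ ha₀ ha₁)
  have h := order_le (f := U * X (Fin.last m) ^ 2 +
      (rename (Fin.succAboveEmb (Fin.last m)) a₀ + rename (Fin.succAboveEmb (Fin.last m)) a₁ * X (Fin.last m)))
    (d := Finsupp.single (Fin.last m) 2) (by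
      rw [coeff_normalForm_of_degree_le U a₀ a₁ ha₀ ha₁ _ (by rw [Finsupp.degree_single]), if_pos rfl]
      exact hU)
  rw [Finsupp.degree_single] at h
  exact_mod_cast h

/-- A normal form with `U(0) ≠ 0` is a singular germ. -/
theorem isSingular_normalForm {U : MvPowerSeries (Fin (m + 1)) k} (hU : constantCoeff U ≠ 0) (a₀ a₁ : MvPowerSeries (Fin m) k)
    (ha₀ : (2 : ℕ∞) < a₀.order) (ha₁ : (1 : ℕ∞) < a₁.order) :
    IsSingular k (U * X (Fin.last m) ^ 2 +
        (rename (Fin.succAboveEmb (Fin.last m)) a₀ + rename (Fin.succAboveEmb (Fin.last m)) a₁ * X (Fin.last m))) := by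
  refine ⟨?_, (FormalCoordChange.two_le_order_iff _).mp (two_le_order_normalForm U a₀ a₁ ha₀ ha₁)⟩
  intro h
  have h2 := order_normalForm hU a₀ a₁ ha₀ ha₁
  rw [h, order_zero] at h2
  exact absurd h2 (by decide)

/-- The tangent quadric of a normal form with `U(0) = 1` is the square `y² = (Σ_l δ_{l,y} x_l)²`. -/
theorem sq_normalForm {U : MvPowerSeries (Fin (m + 1)) k} (hU : constantCoeff U = 1) (a₀ a₁ : MvPowerSeries (Fin m) k)
    (ha₀ : (2 : ℕ∞) < a₀.order) (ha₁ : (1 : ℕ∞) < a₁.order) (i j : Fin (m + 1)) :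
    coeff (Finsupp.single i 1 + Finsupp.single j 1) (U * X (Fin.last m) ^ 2 +
        (rename (Fin.succAboveEmb (Fin.last m)) a₀ + rename (Fin.succAboveEmb (Fin.last m)) a₁ * X (Fin.last m))) =
      coeff (Finsupp.single i 1 + Finsupp.single j 1)
        ((∑ l, C ((Pi.single (Fin.last m) (1 : k) : Fin (m + 1) → k) l) * X l : MvPowerSeries (Fin (m + 1)) k) ^ 2) := by
  classical
  have hdeg : (Finsupp.single i 1 + Finsupp.single j 1 : Fin (m + 1) →₀ ℕ).degree = 2 := by
    rw [map_add, Finsupp.degree_single, Finsupp.degree_single]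
  have hlin : (∑ l, C ((Pi.single (Fin.last m) (1 : k) : Fin (m + 1) → k) l) * X l : MvPowerSeries (Fin (m + 1)) k) =
      X (Fin.last m) := by
    rw [Finset.sum_eq_single (Fin.last m)]
    · rw [Pi.single_eq_same, map_one, one_mul]
    · intro l _ hl
      rw [Pi.single_eq_of_ne hl, map_zero, zero_mul]
    · intro h
      exact absurd (Finset.mem_univ _) h
  rw [coeff_normalForm_of_degree_le U a₀ a₁ ha₀ ha₁ _ hdeg.le, hU, hlin, coeff_X_pow,
    show Finsupp.single (Fin.last m) 2 = Finsupp.single (Fin.last m) 1 + Finsupp.single (Fin.last m) 1 by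
      rw [← Finsupp.single_add]]

end CharTwoDoublePoint

open CharTwoDoublePoint Literature.AlgebraicGeometry.Resolution.CobordantGame in
/-- N2 — CORE W″ AT `d = 2` FROM THE NORMAL FORMS.  If over every algebraically closed field of characteristic `2` every normal form
`U · y² + a₁(x') · y + a₀(x')` (`y = X (Fin.last 2)`, `U(0) = 1`, `ord a₁ ≥ 2`, `ord a₀ ≥ 3`) is won in the local weighted resolution
game, given that the singular germs in `≤ 2` variables are won, then the registered piece `stub_charTwoDoublePointSurfaceWon` holds
(statement copied verbatim as the conclusion). -/
theorem charTwoDoublePointSurfaceWon_of_normalForms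
    (hforms : ∀ (k : Type) [Field k] [CharP k 2] [IsAlgClosed k],
      (∀ m : ℕ, m < 3 → ∀ g : MvPowerSeries (Fin m) k,
        CobordantGame.IsSingular k g → CobordantGame.Won k m g) →
      ∀ (U : MvPowerSeries (Fin 3) k) (a₀ a₁ : MvPowerSeries (Fin 2) k),
        MvPowerSeries.constantCoeff U = 1 → (2 : ℕ∞) < a₀.order → (1 : ℕ∞) < a₁.order →
        CobordantGame.Won k 3 (U * MvPowerSeries.X (Fin.last 2) ^ 2 +
          (MvPowerSeries.rename (Fin.succAboveEmb (Fin.last 2)) a₀ +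
            MvPowerSeries.rename (Fin.succAboveEmb (Fin.last 2)) a₁ * MvPowerSeries.X (Fin.last 2)))) :
    ∀ (k : Type) [Field k] [CharP k 2] [IsAlgClosed k],
      (∀ m : ℕ, m < 3 → ∀ g : MvPowerSeries (Fin m) k,
        CobordantGame.IsSingular k g → CobordantGame.Won k m g) →
      ∀ (f : MvPowerSeries (Fin 3) k), CobordantGame.IsSingular k f →
      (∀ g : MvPowerSeries (Fin 3) k, CobordantGame.IsSingular k g → g.order < f.order →
        CobordantGame.Won k 3 g) →
      f.order = 2 →
      (∃ ℓ : Fin 3 → k, ∀ i j : Fin 3,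
        MvPowerSeries.coeff (Finsupp.single i 1 + Finsupp.single j 1) f =
          MvPowerSeries.coeff (Finsupp.single i 1 + Finsupp.single j 1)
            ((∑ l, MvPowerSeries.C (ℓ l) * MvPowerSeries.X l) ^ 2)) →
      CobordantGame.Won k 3 f := by
  intro k _ _ _ IH f _ _ hf2 hsq
  obtain ⟨ℓ, hℓ⟩ := hsq
  obtain ⟨M, U, a₀, a₁, hMdet, hU, ha₀, ha₁, hfeq⟩ := UnaryConeForm.normalForm_of_sq f hf2 ℓ hℓ
  have hW := hforms k IH U a₀ a₁ hU ha₀ ha₁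
  rw [← hfeq] at hW
  exact (won_subst_iff (ConeDichotomy.constantCoeff_linSubst M) (by rw [linMat_linSubst]; exact hMdet) f).mp hW

open CharTwoDoublePoint Literature.AlgebraicGeometry.Resolution.CobordantGame in
/-- THE CONVERSE BOOKKEEPING: the registered piece `stub_charTwoDoublePointSurfaceWon` (as a hypothesis, verbatim) gives the
normal-form statement — a normal form is itself a singular order-`2` germ with square tangent quadric `y²`, and the
smaller-order hypothesis is vacuous at order `2`.  Hence S2 is EQUIVALENT to «all normal forms are won». -/
theorem normalFormsWon_of_charTwoDoublePointSurfaceWon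
    (hS2 : ∀ (k : Type) [Field k] [CharP k 2] [IsAlgClosed k],
      (∀ m : ℕ, m < 3 → ∀ g : MvPowerSeries (Fin m) k,
        CobordantGame.IsSingular k g → CobordantGame.Won k m g) →
      ∀ (f : MvPowerSeries (Fin 3) k), CobordantGame.IsSingular k f →
      (∀ g : MvPowerSeries (Fin 3) k, CobordantGame.IsSingular k g → g.order < f.order →
        CobordantGame.Won k 3 g) →
      f.order = 2 →
      (∃ ℓ : Fin 3 → k, ∀ i j : Fin 3,
        MvPowerSeries.coeff (Finsupp.single i 1 + Finsupp.single j 1) f =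
          MvPowerSeries.coeff (Finsupp.single i 1 + Finsupp.single j 1)
            ((∑ l, MvPowerSeries.C (ℓ l) * MvPowerSeries.X l) ^ 2)) →
      CobordantGame.Won k 3 f) :
    ∀ (k : Type) [Field k] [CharP k 2] [IsAlgClosed k],
      (∀ m : ℕ, m < 3 → ∀ g : MvPowerSeries (Fin m) k,
        CobordantGame.IsSingular k g → CobordantGame.Won k m g) →
      ∀ (U : MvPowerSeries (Fin 3) k) (a₀ a₁ : MvPowerSeries (Fin 2) k),
        MvPowerSeries.constantCoeff U = 1 → (2 : ℕ∞) < a₀.order → (1 : ℕ∞) < a₁.order →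
        CobordantGame.Won k 3 (U * MvPowerSeries.X (Fin.last 2) ^ 2 +
          (MvPowerSeries.rename (Fin.succAboveEmb (Fin.last 2)) a₀ +
            MvPowerSeries.rename (Fin.succAboveEmb (Fin.last 2)) a₁ * MvPowerSeries.X (Fin.last 2))) := by
  intro k _ _ _ IH U a₀ a₁ hU ha₀ ha₁
  have hU0 : MvPowerSeries.constantCoeff U ≠ 0 := by rw [hU]; exact one_ne_zero
  have hF := isSingular_normalForm hU0 a₀ a₁ ha₀ ha₁
  have hFo := order_normalForm hU0 a₀ a₁ ha₀ ha₁
  refine hS2 k IH _ hF (fun g hg hlt => ?_) hFo ⟨(Pi.single (Fin.last 2) (1 : k) : Fin 3 → k), sq_normalForm hU a₀ a₁ ha₀ ha₁⟩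
  -- no singular germ has order `< 2`
  exfalso
  rw [hFo] at hlt
  have h2 : (2 : ℕ∞) ≤ g.order := (FormalCoordChange.two_le_order_iff g).mpr hg.2
  exact absurd (lt_of_le_of_lt h2 hlt) (lt_irrefl _)

end Summit.ResolutionOfSingularities.ResolutionOfSingularities.Theorems
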